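import Literature.Analysis.FluidPDE.LeiZhang2011LogEstimate
import Literature.Analysis.FluidPDE.LeiZhang2011LowerMass
import Literature.Analysis.FluidPDE.LeiZhang2011MeanValue
import Literature.Analysis.FluidPDE.SignedPowers
import Literature.Analysis.FluidPDE.LeiZhang2011Setting
import HarnessLib

/-!
# Lei–Zhang 2011, Corollary 3.3 and the oscillation estimate (3.8) (tree form)

Analysis/FluidPDE proofs file (theorems only), on the discharge path of the named fact
`Literature.Analysis.FluidPDE.LeiZhang2011_liouville` (Z. Lei, Q. S. Zhang, J. Funct. Anal. 261
(2011) = arXiv:1011.5066, Theorem 1.2). This file combines the three estimates of §3 in the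
tree's form — the mean value inequality (`meanValue_inequality`, (2.7)), the lower mass bound
(`lower_mass`, Lemma 3.4) and the logarithmic estimate (`log_estimate`, Lemma 3.2) — into the
oscillation decay of the swirl over one parabolic cylinder (Corollary 3.3 and (3.8), p. 12:
"`osc_{P(√c₀R/2)} Γ ≤ (1 − δ/4) osc_{P(R,R)} Γ`").

* `bundle_affine_restrict` — the hypotheses of the setting at radius `ρ` for `Γ` give those at
  any radius `r ≤ ρ` for `λΓ + d` (the affine normalisations `Φ = 2(Γ − m)/J`, `2(M − Γ)/J` of
  p. 11 and the regularisation `Φ + ε`);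
* `posPart_const_sub_family` — the power family `((c − v)₊)^m`, `m > 2`, `c ≤ 0`, satisfies the
  hypotheses of `meanValue_inequality` (for `(δ − Φ)₊`, Cor. 3.3);
* `sublevel_measure_le` — "`|{x ∈ B(R/2) : Φ(t,x) ≲ δ}| ≤ R³(1 + ‖b‖²_E)/(−ln δ)`" (p. 10), from
  the logarithmic estimate;
* `oscillation_step` — Corollary 3.3 with (3.8): there are `θ ∈ (0, 1/2]` and `κ < 1`, depending
  only on the `BMO` bound, such that `osc_{Q(θρ)} Γ ≤ κ osc_{Q(ρ)} Γ` for every solution in the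
  setting at radius `ρ` vanishing on the axis.

## References

* Z. Lei, Q. S. Zhang, J. Funct. Anal. 261 (2011) = arXiv:1011.5066, Cor. 3.3, (3.7)–(3.8) and
  the proof of Thm. 1.1, pp. 10–12. [LeiZhang2011]
-/

noncomputable section

open MeasureTheory Set Function Filter Metric intervalIntegral InnerProductSpace
open _root_.Topology
open scoped InnerProductSpace RealInnerProductSpace NNReal ENNReal Laplacian

namespace Literature.Analysis.FluidPDE

namespace LeiZhang2011

open Literature.Analysis.FunctionSpaces

/-! ### Affine images and restrictions of the setting -/

/-- **Affine normalisation and restriction of the setting.** If `Γ` (with `N`, `b`, `B`) is in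
the setting at radius `ρ` (the hypotheses of `lower_mass`/`meanValue_inequality`), then for all
reals `λ, d` and every radius `0 < r ≤ ρ` so is `λΓ + d` with `N` replaced by `λN`, on the
cylinder of radius `r` with the same apex (the equation is linear; time-integrated form rebased
with `integrated_eq_rebase`). Used for `Φ = 2(Γ − m)/J`, `2(M − Γ)/J` and `Φ + ε`
(Lei–Zhang 2011, p. 11). [cite: LeiZhang2011, proof of Thm. 1.1 (arXiv p. 11), the normalisation Φ] -/
theorem bundle_affine_restrict {ρ r lam d : ℝ} (hr : 0 < r) (hrρ : r ≤ ρ) {CB : ℝ≥0}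
    {F N : ℝ → EuclideanSpace ℝ (Fin 3) → ℝ}
    {b Bst : ℝ → EuclideanSpace ℝ (Fin 3) → EuclideanSpace ℝ (Fin 3)}
    (hF2 : ∀ s, ContDiff ℝ 2 (F s)) (hFa : ∀ s, IsAxisymmetricScalar (F s))
    (hBst : ∀ᵐ s ∂(volume.restrict (Ioc (-ρ ^ 2) 0)),
      Differentiable ℝ (Bst s) ∧ curl (Bst s) =ᵐ[volume] b s ∧ eBMOSeminormVec (Bst s) ≤ CB)
    (hN : ∀ s x, N s x =
      (Δ (F s)) x - fderiv ℝ (F s) x (b s x) - 2 / cylRadius x * fderiv ℝ (F s) x (eR x))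
    (heq : ∀ᵐ x ∂(volume : Measure (EuclideanSpace ℝ (Fin 3))),
      IntervalIntegrable (fun s => N s x) volume (-ρ ^ 2) 0 ∧
        ∀ s ∈ Icc (-ρ ^ 2) 0, F s x = F (-ρ ^ 2) x + ∫ τ in (-ρ ^ 2)..s, N τ x)
    (hFc : Continuous fun p : ℝ × EuclideanSpace ℝ (Fin 3) => F p.1 p.2)
    (hF1c : Continuous fun p : ℝ × EuclideanSpace ℝ (Fin 3) => gradient (F p.1) p.2)
    (hNm : AEStronglyMeasurable (fun p : ℝ × EuclideanSpace ℝ (Fin 3) => N p.1 p.2)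
      ((volume.restrict (Ioc (-ρ ^ 2) 0)).prod volume))
    (hNi : Integrable (fun p : ℝ × EuclideanSpace ℝ (Fin 3) => N p.1 p.2)
      ((volume.restrict (Ioc (-ρ ^ 2) 0)).prod (volume.restrict (closedBall 0 ρ))))
    (hbm : AEStronglyMeasurable (fun p : ℝ × EuclideanSpace ℝ (Fin 3) => b p.1 p.2)
      ((volume.restrict (Ioc (-ρ ^ 2) 0)).prod volume))
    {Mb : ℝ} (hbB : ∀ s, ∀ x ∈ closedBall (0 : EuclideanSpace ℝ (Fin 3)) ρ, ‖b s x‖ ≤ Mb) :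
    (∀ s, ContDiff ℝ 2 (fun x => lam * F s x + d)) ∧
    (∀ s, IsAxisymmetricScalar (fun x => lam * F s x + d)) ∧
    (∀ᵐ s ∂(volume.restrict (Ioc (-r ^ 2) 0)),
      Differentiable ℝ (Bst s) ∧ curl (Bst s) =ᵐ[volume] b s ∧ eBMOSeminormVec (Bst s) ≤ CB) ∧
    (∀ s x, lam * N s x =
      (Δ (fun y => lam * F s y + d)) x - fderiv ℝ (fun y => lam * F s y + d) x (b s x) -
        2 / cylRadius x * fderiv ℝ (fun y => lam * F s y + d) x (eR x)) ∧
    (∀ᵐ x ∂(volume : Measure (EuclideanSpace ℝ (Fin 3))),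
      IntervalIntegrable (fun s => lam * N s x) volume (-r ^ 2) 0 ∧
        ∀ s ∈ Icc (-r ^ 2) 0, lam * F s x + d = (lam * F (-r ^ 2) x + d) + ∫ τ in (-r ^ 2)..s, lam * N τ x) ∧
    (Continuous fun p : ℝ × EuclideanSpace ℝ (Fin 3) => lam * F p.1 p.2 + d) ∧
    (Continuous fun p : ℝ × EuclideanSpace ℝ (Fin 3) => gradient (fun y => lam * F p.1 y + d) p.2) ∧
    AEStronglyMeasurable (fun p : ℝ × EuclideanSpace ℝ (Fin 3) => lam * N p.1 p.2)
      ((volume.restrict (Ioc (-r ^ 2) 0)).prod volume) ∧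
    Integrable (fun p : ℝ × EuclideanSpace ℝ (Fin 3) => lam * N p.1 p.2)
      ((volume.restrict (Ioc (-r ^ 2) 0)).prod (volume.restrict (closedBall 0 r))) ∧
    AEStronglyMeasurable (fun p : ℝ × EuclideanSpace ℝ (Fin 3) => b p.1 p.2)
      ((volume.restrict (Ioc (-r ^ 2) 0)).prod volume) ∧
    (∀ s, ∀ x ∈ closedBall (0 : EuclideanSpace ℝ (Fin 3)) r, ‖b s x‖ ≤ Mb) := by
  have hrr : -ρ ^ 2 ≤ -r ^ 2 := by nlinarith
  have hr0 : -r ^ 2 ≤ (0 : ℝ) := by nlinarith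
  have hI : Ioc (-r ^ 2) (0 : ℝ) ⊆ Ioc (-ρ ^ 2) 0 := Ioc_subset_Ioc hrr le_rfl
  have hball : closedBall (0 : EuclideanSpace ℝ (Fin 3)) r ⊆ closedBall 0 ρ := closedBall_subset_closedBall hrρ
  have hμ₁ : (volume.restrict (Ioc (-r ^ 2) (0 : ℝ))).prod (volume : Measure (EuclideanSpace ℝ (Fin 3))) ≤
      (volume.restrict (Ioc (-ρ ^ 2) 0)).prod volume :=
    Measure.prod_mono (Measure.restrict_mono hI le_rfl) le_rfl
  have hμ₂ : (volume.restrict (Ioc (-r ^ 2) (0 : ℝ))).prod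
        ((volume : Measure (EuclideanSpace ℝ (Fin 3))).restrict (closedBall 0 r)) ≤
      (volume.restrict (Ioc (-ρ ^ 2) 0)).prod (volume.restrict (closedBall 0 ρ)) :=
    Measure.prod_mono (Measure.restrict_mono hI le_rfl) (Measure.restrict_mono hball le_rfl)
  -- the affine map `v ↦ λ v + d`
  have haff : ∀ s, (fun x => lam * F s x + d) = fun x => (fun v : ℝ => lam * v + d) (F s x) := fun s => rfl
  have haffd : ∀ v : ℝ, deriv (fun v : ℝ => lam * v + d) v = lam := by
    intro v
    rw [deriv_add_const, deriv_const_mul _ differentiableAt_id, deriv_id'', mul_one]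
  have haffD : Differentiable ℝ fun v : ℝ => lam * v + d :=
    (differentiable_id.const_mul lam).add_const d
  have hF2' : ∀ s, ContDiff ℝ 2 (fun x => lam * F s x + d) := fun s =>
    (contDiff_const.mul (hF2 s)).add contDiff_const
  have hgrad : ∀ s x, gradient (fun y => lam * F s y + d) x = lam • gradient (F s) x := by
    intro s x
    rw [haff s, gradient_comp_apply (haffD _) (((hF2 s).differentiable two_ne_zero) x), haffd]
  have hfderiv : ∀ s x, fderiv ℝ (fun y => lam * F s y + d) x = lam • fderiv ℝ (F s) x := by
    intro s x
    have hd : DifferentiableAt ℝ (F s) x := ((hF2 s).differentiable two_ne_zero) x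
    rw [show (fun y => lam * F s y + d) = fun y => lam * F s y + d from rfl, fderiv_add_const,
      fderiv_const_mul hd]
  have hlap : ∀ s x, (Δ (fun y => lam * F s y + d)) x = lam * (Δ (F s)) x := by
    intro s x
    have e : (fun y => lam * F s y + d) = (lam • F s) + fun _ => d := by
      funext y; simp [smul_eq_mul]
    have h1 : ContDiffAt ℝ 2 (lam • F s) x := ((hF2 s).const_smul lam).contDiffAt
    rw [e, h1.laplacian_add contDiffAt_const, laplacian_smul lam (hF2 s).contDiffAt, laplacian_const]
    simp [smul_eq_mul]
  refine ⟨hF2', fun s θ x => by simp only [hFa s θ x], ae_restrict_of_ae_restrict_of_subset hI hBst,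
    fun s x => ?_, ?_, (continuous_const.mul hFc).add continuous_const, ?_, (hNm.mono_measure hμ₁).const_mul lam,
    (hNi.mono_measure hμ₂).const_mul lam, hbm.mono_measure hμ₁, fun s x hx => hbB s x (hball hx)⟩
  · -- the equation for `λΓ + d`
    rw [hlap, hfderiv, hN s x]
    have e1 : (lam • fderiv ℝ (F s) x) (b s x) = lam * fderiv ℝ (F s) x (b s x) := rfl
    have e2 : (lam • fderiv ℝ (F s) x) (eR x) = lam * fderiv ℝ (F s) x (eR x) := rfl
    rw [e1, e2]
    ring
  · -- the time-integrated form, rebased at `−r²`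
    filter_upwards [heq] with x hx
    obtain ⟨hi, hrep⟩ := integrated_eq_rebase (Fx := fun s => F s x) (Nx := fun s => N s x) hrr hr0 hx.1 hx.2
    refine ⟨hi.const_mul lam, fun s hs => ?_⟩
    rw [intervalIntegral.integral_const_mul, hrep s hs]
    ring
  · -- joint continuity of the gradient
    have e : (fun p : ℝ × EuclideanSpace ℝ (Fin 3) => gradient (fun y => lam * F p.1 y + d) p.2) =
        fun p => lam • gradient (F p.1) p.2 := funext fun p => hgrad p.1 p.2
    rw [e]
    exact hF1c.const_smul lam

/-! ### The power family `((c − v)₊)^m` -/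

/-- **The reflected positive-part power family satisfies the hypotheses of the mean value
inequality.** For `c ≤ 0`, `w(v) = (c − v)₊ ≥ 0` is continuous and, for every `m > 2`,
`H_m = w^m ∈ C²` with `H_m(0) = 0`, `H_m'' ≥ 0`, `H_m'² ≤ (m/(m−1)) H_m H_m''`, and
`s_m = w^{m/2} ∈ C¹` with `s_m² = H_m`, `2 s_m'² ≤ H_m''` (`SignedPowers`). With `c = δ − a`,
`F = Φ − a`: `w(F) = (δ − Φ)₊` (Lei–Zhang 2011, Cor. 3.3). [cite: LeiZhang2011, Cor. 3.3 (arXiv p. 10), the function (δ − Φ)₊] -/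
theorem posPart_const_sub_family {c : ℝ} (hc : c ≤ 0) :
    (∀ v, 0 ≤ max (c - v) 0) ∧ (Continuous fun v : ℝ => max (c - v) 0) ∧
    (∀ (m : ℝ) (v : ℝ), 2 < m → max (c - v) 0 ^ m = max (c - v) 0 ^ m) ∧
    (∀ m : ℝ, 2 < m →
      ContDiff ℝ 2 (fun v : ℝ => max (c - v) 0 ^ m) ∧ max (c - 0) 0 ^ m = 0 ∧
      (∀ v, 0 ≤ deriv (deriv fun v : ℝ => max (c - v) 0 ^ m) v) ∧
      (∀ v, deriv (fun v : ℝ => max (c - v) 0 ^ m) v ^ 2 ≤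
        m / (m - 1) * (max (c - v) 0 ^ m * deriv (deriv fun v : ℝ => max (c - v) 0 ^ m) v)) ∧
      ContDiff ℝ 1 (fun v : ℝ => max (c - v) 0 ^ (m / 2)) ∧
      (∀ v, (max (c - v) 0 ^ (m / 2)) ^ 2 = max (c - v) 0 ^ m) ∧
      (∀ v, 2 * deriv (fun v : ℝ => max (c - v) 0 ^ (m / 2)) v ^ 2 ≤
        deriv (deriv fun v : ℝ => max (c - v) 0 ^ m) v)) := by
  refine ⟨fun v => le_max_right _ _, (continuous_const.sub continuous_id).max continuous_const,
    fun m v _ => rfl, fun m hm => ?_⟩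
  exact ⟨contDiff_two_posPart_const_sub_rpow hm c, posPart_const_sub_rpow_zero hc (by linarith),
    deriv_deriv_posPart_const_sub_rpow_nonneg hm c, deriv_posPart_const_sub_rpow_sq_le hm c,
    contDiff_one_posPart_const_sub_rpow_half hm c, posPart_const_sub_rpow_half_sq m c,
    two_mul_deriv_posPart_const_sub_rpow_half_sq_le hm c⟩

/-! ### The measure of the sublevel sets from the logarithmic estimate -/

/-- **The measure of a sublevel set from the logarithmic mean** (Lei–Zhang 2011, proof of
Cor. 3.3, p. 10: "`|{x ∈ B(R/2) : Φ(t,x) ≲ δ}| ≤ R³(1 + ‖b‖²_E)/(−ln δ)`"). For one slice `F`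
with `F ≤ 3` on `B̄(0,ρ)`, `0 < 2δ < 1` and `φ = radialCutoff (ρ/2) ρ`:
`ln(1/(2δ)) · |{F < 2δ} ∩ B̄(0,ρ/2)| ≤ ∫ (−ln F) φ² + (ln 3) ρ³ |B₁|` (pointwise
`ln(1/(2δ)) 1_S ≤ (−ln F)φ² + (ln 3)φ²`, `φ = 1` on `B̄(0,ρ/2)`, `∫φ² ≤ ρ³|B₁|`). [cite: LeiZhang2011, proof of Cor. 3.3 (arXiv p. 10)] -/
theorem sublevel_measure_le {ρ ε δ : ℝ} (hρ : 0 < ρ) (hε : 0 < ε) (hδ : 0 < δ) (hδ1 : 2 * δ < 1)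
    {F : EuclideanSpace ℝ (Fin 3) → ℝ} (hF : Continuous F)
    (hFb : ∀ x ∈ closedBall (0 : EuclideanSpace ℝ (Fin 3)) ρ, ε ≤ F x ∧ F x ≤ 3) :
    Real.log (1 / (2 * δ)) * volume.real ({x | F x < 2 * δ} ∩ closedBall (0 : EuclideanSpace ℝ (Fin 3)) (ρ / 2)) ≤
      (∫ x, -Real.log (F x) * radialCutoff (ρ / 2) ρ x ^ 2) +
        Real.log 3 * (ρ ^ 3 * volume.real (ball (0 : EuclideanSpace ℝ (Fin 3)) 1)) := by
  obtain ⟨-, hZhi⟩ := radialCutoff_sq_mass hρ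
  set φ : EuclideanSpace ℝ (Fin 3) → ℝ := radialCutoff (ρ / 2) ρ with hφdef
  set L : ℝ := Real.log (1 / (2 * δ)) with hL
  set S : Set (EuclideanSpace ℝ (Fin 3)) := {x | F x < 2 * δ} ∩ closedBall 0 (ρ / 2) with hS
  have hρ2 : 0 ≤ ρ / 2 := by positivity
  have hρρ : ρ / 2 < ρ := half_lt_self hρ
  have hL0 : 0 < L := Real.log_pos (by rw [lt_div_iff₀ (by positivity)]; linarith)
  have hlog3 : 0 < Real.log 3 := Real.log_pos (by norm_num)
  have hφc : Continuous φ := (radialCutoff_contDiff (ρ / 2) ρ (n := 0)).continuous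
  have hφcs : HasCompactSupport φ := hasCompactSupport_radialCutoff hρ2 hρρ
  have hφ2cs : HasCompactSupport fun x => φ x ^ 2 := hφcs.comp_left (g := fun t : ℝ => t ^ 2) (by simp)
  have hφ2c : Continuous fun x => φ x ^ 2 := hφc.pow 2
  have hφK : ∀ x, x ∉ closedBall (0 : EuclideanSpace ℝ (Fin 3)) ρ → φ x = 0 := fun x hx =>
    radialCutoff_eq_zero hρ2 hρρ (le_of_lt (by rwa [mem_closedBall_zero_iff, not_le] at hx))
  have hφone : ∀ x ∈ closedBall (0 : EuclideanSpace ℝ (Fin 3)) (ρ / 2), φ x = 1 := fun x hx =>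
    radialCutoff_eq_one hρ2 hρρ (mem_closedBall_zero_iff.1 hx)
  have hSm : MeasurableSet S := (isOpen_lt hF continuous_const).measurableSet.inter measurableSet_closedBall
  have hSfin : volume S ≠ ∞ := measure_ne_top_of_subset inter_subset_right measure_closedBall_lt_top.ne
  -- pointwise: `L 1_S ≤ (−log F) φ² + (log 3) φ²`
  have hpt : ∀ x, S.indicator (fun _ => L) x ≤ -Real.log (F x) * φ x ^ 2 + Real.log 3 * φ x ^ 2 := by
    intro x
    by_cases hxK : x ∈ closedBall (0 : EuclideanSpace ℝ (Fin 3)) ρ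
    · obtain ⟨hlo, hhi⟩ := hFb x hxK
      have hF0 : 0 < F x := hε.trans_le hlo
      have hlogle : Real.log (F x) ≤ Real.log 3 := Real.log_le_log hF0 hhi
      by_cases hx : x ∈ S
      · rw [indicator_of_mem hx, hφone x hx.2]
        have h1 : L ≤ -Real.log (F x) := by
          rw [hL, one_div, Real.log_inv]
          exact neg_le_neg (Real.log_le_log hF0 hx.1.le)
        nlinarith
      · rw [indicator_of_notMem hx]
        nlinarith [sq_nonneg (φ x)]
    · have hx : x ∉ S := fun h => hxK (closedBall_subset_closedBall hρρ.le h.2)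
      rw [indicator_of_notMem hx, hφK x hxK]
      simp
  -- integrate
  have hi1 : Integrable (S.indicator fun _ => L) (volume : Measure (EuclideanSpace ℝ (Fin 3))) :=
    (integrable_indicator_iff hSm).2 (integrableOn_const hSfin)
  have hi2 : Integrable (fun x => -Real.log (F x) * φ x ^ 2) (volume : Measure (EuclideanSpace ℝ (Fin 3))) := by
    -- `−log F · φ²` is continuous where `φ ≠ 0` might fail (`F` may vanish off `B̄_ρ`), so use the
    -- clamped logarithm, which agrees with it everywhere against `φ²`
    have hc : Continuous fun x => -Real.log (max ε (F x)) * φ x ^ 2 :=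
      ((continuous_const.max hF).log fun x => (hε.trans_le (le_max_left _ _)).ne').neg.mul hφ2c
    refine (hc.integrable_of_hasCompactSupport hφ2cs.mul_left).congr (ae_of_all _ fun x => ?_)
    show -Real.log (max ε (F x)) * φ x ^ 2 = -Real.log (F x) * φ x ^ 2
    by_cases hxK : x ∈ closedBall (0 : EuclideanSpace ℝ (Fin 3)) ρ
    · rw [max_eq_right (hFb x hxK).1]
    · rw [hφK x hxK]; simp
  have hi3 : Integrable (fun x => Real.log 3 * φ x ^ 2) (volume : Measure (EuclideanSpace ℝ (Fin 3))) :=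
    (hφ2c.integrable_of_hasCompactSupport hφ2cs).const_mul _
  calc L * volume.real S = ∫ x, S.indicator (fun _ => L) x := by
        rw [MeasureTheory.integral_indicator hSm, setIntegral_const, smul_eq_mul, mul_comm]
    _ ≤ ∫ x, (-Real.log (F x) * φ x ^ 2 + Real.log 3 * φ x ^ 2) := integral_mono hi1 (hi2.add hi3) hpt
    _ = (∫ x, -Real.log (F x) * φ x ^ 2) + Real.log 3 * ∫ x, φ x ^ 2 := by
        rw [integral_add hi2 hi3, MeasureTheory.integral_const_mul]
    _ ≤ (∫ x, -Real.log (F x) * φ x ^ 2) + Real.log 3 * (ρ ^ 3 * volume.real (ball (0 : EuclideanSpace ℝ (Fin 3)) 1)) :=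
        add_le_add le_rfl (mul_le_mul_of_nonneg_left hZhi hlog3.le)


/-! ### Corollary 3.3 and (3.8): the oscillation decay over one cylinder -/

set_option maxHeartbeats 1600000 in
-- one long assembly proof (three normalised bundles, Lemma 3.4, Lemma 3.2, the sublevel sets,
-- the mean value inequality in `L⁴`, the choice of `δ`, and the two cases of the normalisation)
/-- **Corollary 3.3 with the oscillation estimate (3.8) of Lei–Zhang 2011 (tree form).** For
every `BMO` bound `C_B` there are `θ ∈ (0, 1/2]` and `κ ∈ [0, 1)` such that for every radius
`ρ > 0` and every solution `Γ` of the swirl equation in the setting at radius `ρ` (hypotheses of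
`meanValue_inequality`: `Γ(s,·) ∈ C²` axisymmetric vanishing on the axis, drift `b = curl B`
with `‖B(s)‖_BMO ≤ C_B` for a.e. `s`, the equation in time-integrated form, joint continuity and
integrability) with `m ≤ Γ ≤ M` on `[−ρ², 0] × B̄(0,ρ)`, the oscillation of `Γ` over
`[−(θρ)², 0] × B̄(0,θρ)` is at most `κ (M − m)`. Proof as printed (pp. 10–12): normalise
`Φ = 2(Γ − m)/J` or `2(M − Γ)/J` (`J = M − m`) so that `0 ≤ Φ ≤ 2` and `Φ ≥ 1` on the axis;
Lemma 3.4 (`lower_mass`) and Lemma 3.2 (`log_estimate`) for `Φ + ε` bound the measure of the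
sublevel sets `{Φ(t) < δ}` (`sublevel_measure_le`); the mean value inequality
(`meanValue_inequality`) for `(δ − Φ)₊` in `L⁴` then gives `Φ ≥ δ/2` on the small cylinder for
`δ = δ(C_B)` small, i.e. `osc ≤ (1 − δ/4) J`. [cite: LeiZhang2011, Cor. 3.3 and (3.8) (arXiv pp. 10–12)] -/
theorem oscillation_step (CB : ℝ≥0) :
    ∃ θ κd : ℝ, 0 < θ ∧ θ ≤ 1 / 2 ∧ 0 ≤ κd ∧ κd < 1 ∧ ∀ ⦃ρ : ℝ⦄, 0 < ρ →
      ∀ ⦃F N : ℝ → EuclideanSpace ℝ (Fin 3) → ℝ⦄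
        ⦃b Bst : ℝ → EuclideanSpace ℝ (Fin 3) → EuclideanSpace ℝ (Fin 3)⦄,
      (∀ s, ContDiff ℝ 2 (F s)) → (∀ s, IsAxisymmetricScalar (F s)) →
      (∀ s x, cylRadius x = 0 → F s x = 0) →
      (∀ s, LocallyIntegrable (b s) volume) →
      (∀ᵐ s ∂(volume.restrict (Ioc (-ρ ^ 2) 0)),
        Differentiable ℝ (Bst s) ∧ curl (Bst s) =ᵐ[volume] b s ∧ eBMOSeminormVec (Bst s) ≤ CB) →
      (∀ s x, N s x =
        (Δ (F s)) x - fderiv ℝ (F s) x (b s x) - 2 / cylRadius x * fderiv ℝ (F s) x (eR x)) →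
      (∀ᵐ x ∂(volume : Measure (EuclideanSpace ℝ (Fin 3))),
        IntervalIntegrable (fun s => N s x) volume (-ρ ^ 2) 0 ∧
          ∀ s ∈ Icc (-ρ ^ 2) 0, F s x = F (-ρ ^ 2) x + ∫ τ in (-ρ ^ 2)..s, N τ x) →
      (Continuous fun p : ℝ × EuclideanSpace ℝ (Fin 3) => F p.1 p.2) →
      (Continuous fun p : ℝ × EuclideanSpace ℝ (Fin 3) => gradient (F p.1) p.2) →
      AEStronglyMeasurable (fun p : ℝ × EuclideanSpace ℝ (Fin 3) => N p.1 p.2)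
        ((volume.restrict (Ioc (-ρ ^ 2) 0)).prod volume) →
      Integrable (fun p : ℝ × EuclideanSpace ℝ (Fin 3) => N p.1 p.2)
        ((volume.restrict (Ioc (-ρ ^ 2) 0)).prod (volume.restrict (closedBall 0 ρ))) →
      AEStronglyMeasurable (fun p : ℝ × EuclideanSpace ℝ (Fin 3) => b p.1 p.2)
        ((volume.restrict (Ioc (-ρ ^ 2) 0)).prod volume) →
      ∀ ⦃Mb : ℝ⦄, (∀ s, ∀ x ∈ closedBall (0 : EuclideanSpace ℝ (Fin 3)) ρ, ‖b s x‖ ≤ Mb) →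
      ∀ ⦃m M : ℝ⦄, (∀ s ∈ Icc (-ρ ^ 2) 0, ∀ x ∈ closedBall (0 : EuclideanSpace ℝ (Fin 3)) ρ,
        m ≤ F s x ∧ F s x ≤ M) →
      ∀ p ∈ Icc (-(θ * ρ) ^ 2) 0 ×ˢ closedBall (0 : EuclideanSpace ℝ (Fin 3)) (θ * ρ),
      ∀ q ∈ Icc (-(θ * ρ) ^ 2) 0 ×ˢ closedBall (0 : EuclideanSpace ℝ (Fin 3)) (θ * ρ),
        F p.1 p.2 - F q.1 q.2 ≤ κd * (M - m) := by
  -- ### the constants depending only on `CB`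
  obtain ⟨Cmv, hCmv0, hMV⟩ := meanValue_inequality CB
  obtain ⟨cl, hcl0, hLM⟩ := lower_mass CB
  obtain ⟨ct, M₀, hct0, hct8, hM₀0, hLE⟩ := log_estimate CB (m₀ := cl / 32) (by positivity)
  set V₁ : ℝ := volume.real (ball (0 : EuclideanSpace ℝ (Fin 3)) 1) with hV₁
  have hV₁0 : 0 < V₁ := by
    rw [hV₁, measureReal_def]
    exact ENNReal.toReal_pos (measure_ball_pos volume _ one_pos).ne' measure_ball_lt_top.ne
  have hlog3 : 0 < Real.log 3 := Real.log_pos (by norm_num)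
  set C₁ : ℝ := M₀ + Real.log 3 * V₁ with hC₁
  have hC₁0 : 0 < C₁ := by positivity
  set Lc : ℝ := 16 * Cmv ^ 4 * C₁ * ct ^ (-(3 / 2 : ℝ)) + 1 with hLc
  have hLc1 : 1 ≤ Lc := by
    have h : 0 ≤ 16 * Cmv ^ 4 * C₁ * ct ^ (-(3 / 2 : ℝ)) := by positivity
    rw [hLc]
    linarith
  have hLc0 : 0 < Lc := by linarith
  set δ : ℝ := Real.exp (-Lc) / 2 with hδ
  have hδ0 : 0 < δ := by positivity
  have h2δ : 2 * δ = Real.exp (-Lc) := by rw [hδ]; ring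
  have h2δ1 : 2 * δ < 1 := by rw [h2δ]; exact Real.exp_lt_one_iff.2 (by linarith)
  have hδ1 : δ < 1 := by linarith
  have hlogδ : Real.log (1 / (2 * δ)) = Lc := by rw [h2δ, one_div, Real.log_inv, Real.log_exp, neg_neg]
  set ε : ℝ := δ / 4 with hε
  have hε0 : 0 < ε := by positivity
  have hε1 : ε ≤ 1 := by rw [hε]; linarith
  set θ : ℝ := Real.sqrt ct / 2 with hθ
  have hsct0 : 0 < Real.sqrt ct := Real.sqrt_pos.2 hct0
  have hsct : Real.sqrt ct ≤ 1 / 2 := by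
    rw [show (1 / 2 : ℝ) = Real.sqrt (1 / 4) by rw [show (1/4:ℝ) = (1/2)^2 by norm_num, Real.sqrt_sq (by norm_num)]]
    exact Real.sqrt_le_sqrt (by linarith)
  have hθ0 : 0 < θ := by positivity
  have hθ2 : θ ≤ 1 / 2 := by rw [hθ]; linarith
  refine ⟨θ, 1 - δ / 4, hθ0, hθ2, by linarith, by linarith, ?_⟩
  intro ρ hρ F N b Bst hF2 hFa hF0 hb hBst hN heq hFc hF1c hNm hNi hbm Mb hbB m M hmM p hp q hq
  -- ### elementary consequences
  have hρ' : 0 < Real.sqrt ct * ρ := by positivity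
  have hρ'ρ : Real.sqrt ct * ρ ≤ ρ := by nlinarith
  have hρ'2 : Real.sqrt ct * ρ ≤ ρ / 2 := by nlinarith
  have hρ'sq : (Real.sqrt ct * ρ) ^ 2 = ct * ρ ^ 2 := by rw [mul_pow, Real.sq_sqrt hct0.le]
  have hθρ : θ * ρ = Real.sqrt ct * ρ / 2 := by rw [hθ]; ring
  -- the small cylinder lies in the big one
  have hsmall : Icc (-(θ * ρ) ^ 2) 0 ×ˢ closedBall (0 : EuclideanSpace ℝ (Fin 3)) (θ * ρ) ⊆
      Icc (-ρ ^ 2) 0 ×ˢ closedBall 0 ρ := by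
    refine prod_mono (Icc_subset_Icc (by nlinarith [hθ0, hθ2]) le_rfl) (closedBall_subset_closedBall (by nlinarith [hθ0, hθ2]))
  -- `m ≤ 0 ≤ M` (the axis meets the cylinder)
  have h00 : F 0 0 = 0 := hF0 0 0 (by simp [cylRadius])
  have hm0 : m ≤ 0 ∧ 0 ≤ M := by
    have h := hmM 0 ⟨by nlinarith, le_rfl⟩ 0 (mem_closedBall_self hρ.le)
    rw [h00] at h; exact h
  set J : ℝ := M - m with hJ
  have hJ0 : 0 ≤ J := by rw [hJ]; linarith [hm0.1, hm0.2]
  -- the trivial bound `F p − F q ≤ J`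
  have hFp := hmM p.1 (hsmall hp).1 p.2 (hsmall hp).2
  have hFq := hmM q.1 (hsmall hq).1 q.2 (hsmall hq).2
  rcases hJ0.eq_or_lt with hJ00 | hJpos
  · have : F p.1 p.2 - F q.1 q.2 ≤ 0 := by rw [hJ] at hJ00; linarith [hFp.2, hFq.1]
    have : (1 - δ / 4) * (M - m) = 0 := by rw [← hJ, ← hJ00]; ring
    linarith
  -- ### the key step: `Φ ≥ δ/2` on the small cylinder, for a normalisation `Φ = λF + a`
  have key : ∀ lam a : ℝ, 1 ≤ a →
      (∀ s ∈ Icc (-ρ ^ 2) 0, ∀ x ∈ closedBall (0 : EuclideanSpace ℝ (Fin 3)) ρ,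
        0 ≤ lam * F s x + a ∧ lam * F s x + a ≤ 2) →
      ∀ p ∈ Icc (-(θ * ρ) ^ 2) 0 ×ˢ closedBall (0 : EuclideanSpace ℝ (Fin 3)) (θ * ρ),
        δ / 2 ≤ lam * F p.1 p.2 + a := by
    intro lam a ha hΦ
    -- the three bundles: `λF + (a+ε)` at radii `ρ` and `ρ/2`, `λF` at radius `ρ' = √ct ρ`
    obtain ⟨hF2l, hFal, hBstl, hNl, heql, hFcl, hF1cl, hNml, hNil, hbml, hbBl⟩ :=
      bundle_affine_restrict (lam := lam) (d := a + ε) hρ le_rfl hF2 hFa hBst hN heq hFc hF1c hNm hNi hbm hbB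
    obtain ⟨hF2h, hFah, hBsth, hNh, heqh, hFch, hF1ch, hNmh, hNih, hbmh, hbBh⟩ :=
      bundle_affine_restrict (lam := lam) (d := a + ε) (half_pos hρ) (half_le_self hρ.le) hF2 hFa hBst hN heq hFc hF1c
        hNm hNi hbm hbB
    obtain ⟨hF2v, hFav, hBstv, hNv, heqv, hFcv, hF1cv, hNmv, hNiv, hbmv, hbBv⟩ :=
      bundle_affine_restrict (lam := lam) (d := 0) hρ' hρ'ρ hF2 hFa hBst hN heq hFc hF1c hNm hNi hbm hbB
    -- bounds of `λF + (a+ε)` on the cylinders and on the axis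
    have haxis : ∀ s (z : ℝ), F s (meridianPoint (0, z)) = 0 := fun s z =>
      hF0 s _ (by rw [cylRadius_meridianPoint_eq_abs, abs_zero])
    have hFbl : ∀ s ∈ Icc (-ρ ^ 2) 0, ∀ x ∈ closedBall (0 : EuclideanSpace ℝ (Fin 3)) ρ,
        ε ≤ lam * F s x + (a + ε) ∧ lam * F s x + (a + ε) ≤ 3 := by
      intro s hs x hx
      have h := hΦ s hs x hx
      constructor <;> linarith [h.1, h.2]
    have hFaxl : ∀ s ∈ Icc (-ρ ^ 2) 0, ∀ z : ℝ, |z| ≤ ρ → 1 ≤ lam * F s (meridianPoint (0, z)) + (a + ε) := by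
      intro s _ z _
      rw [haxis]; linarith
    have hIh : Icc (-(ρ / 2) ^ 2) (0 : ℝ) ⊆ Icc (-ρ ^ 2) 0 := Icc_subset_Icc (by nlinarith) le_rfl
    have hBh : closedBall (0 : EuclideanSpace ℝ (Fin 3)) (ρ / 2) ⊆ closedBall 0 ρ := closedBall_subset_closedBall (by linarith)
    have hFbh : ∀ s ∈ Icc (-(ρ / 2) ^ 2) 0, ∀ x ∈ closedBall (0 : EuclideanSpace ℝ (Fin 3)) (ρ / 2),
        ε ≤ lam * F s x + (a + ε) ∧ lam * F s x + (a + ε) ≤ 3 := fun s hs x hx => hFbl s (hIh hs) x (hBh hx)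
    have hFaxh : ∀ s ∈ Icc (-(ρ / 2) ^ 2) 0, ∀ z : ℝ, |z| ≤ ρ / 2 →
        1 ≤ lam * F s (meridianPoint (0, z)) + (a + ε) := fun s hs z hz => hFaxl s (hIh hs) z (by linarith)
    -- Lemma 3.4 at radius `ρ/2`: the mass lower bound
    have hmass0 := hLM (half_pos hρ) hε0 hε1 hF2h hFah hb hBsth hNh heqh hFch hF1ch hNmh hNih hbmh hbBh hFbh hFaxh
    have hmass : cl / 32 * ρ ^ 5 ≤ ∫ s in (-(ρ ^ 2 / 4))..0,
        ∫ x in closedBall (0 : EuclideanSpace ℝ (Fin 3)) (ρ / 2), (lam * F s x + (a + ε)) ^ (1 / 4 : ℝ) := by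
      have e1 : cl / 32 * ρ ^ 5 = cl * (ρ / 2) ^ 5 := by ring
      have e2 : -(ρ ^ 2 / 4) = -(ρ / 2) ^ 2 := by ring
      rw [e1, e2]; exact hmass0
    -- Lemma 3.2 at radius `ρ`: the logarithmic estimate
    have hlog := hLE hρ hε0 hε1 hF2l hFal hb hBstl hNl heql hFcl hF1cl hNml hNil hbml hbBl hFbl hFaxl hmass
    -- the sublevel sets `{Φ(t) < δ} ∩ B̄(ρ/2)`, for `t ∈ [−ct ρ², 0]`
    have hsub : ∀ t ∈ Icc (-(ct * ρ ^ 2)) 0,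
        volume.real ({x | lam * F t x + (a + ε) < 2 * δ} ∩ closedBall (0 : EuclideanSpace ℝ (Fin 3)) (ρ / 2)) ≤
          C₁ * ρ ^ 3 / Lc := by
      intro t ht
      have htI : t ∈ Icc (-ρ ^ 2) 0 := ⟨le_trans (by nlinarith) ht.1, ht.2⟩
      have h := sublevel_measure_le hρ hε0 hδ0 h2δ1 (F := fun x => lam * F t x + (a + ε))
        ((continuous_const.mul (hF2 t).continuous).add continuous_const) (hFbl t htI)
      rw [hlogδ, ← hV₁] at h
      have h2 := hlog t ht
      rw [le_div_iff₀ hLc0, hC₁]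
      nlinarith [h, h2]
    -- ### the mean value inequality for `(δ − Φ)₊ = (c − λF)₊`, `c = δ − a ≤ 0`, at radius `ρ'`
    have hc : δ - a ≤ 0 := by linarith
    obtain ⟨hw0, hwc, hHw, hfam⟩ := posPart_const_sub_family hc
    have hF0v : ∀ s x, cylRadius x = 0 → lam * F s x + 0 = 0 := fun s x hx => by rw [hF0 s x hx]; ring
    have hMVI := hMV hρ' hF2v hFav hF0v hb hBstv hNv heqv hFcv hF1cv hNmv hNiv hbmv hbBv hw0 hwc
      (Hf := fun m v => max (δ - a - v) 0 ^ m) (sf := fun m v => max (δ - a - v) 0 ^ (m / 2)) hHw hfam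
    -- the `L⁴` norm over `Q(ρ')`
    set g : ℝ × EuclideanSpace ℝ (Fin 3) → ℝ := fun p => max (δ - a - (lam * F p.1 p.2 + 0)) 0 with hgdef
    have hgc : Continuous g := (continuous_const.sub ((continuous_const.mul hFc).add continuous_const)).max continuous_const
    have hg0 : ∀ p, 0 ≤ g p := fun p => le_max_right _ _
    set ρ₁ : ℝ := Real.sqrt ct * ρ with hρ₁
    have hIv : Ioc (-ρ₁ ^ 2) (0 : ℝ) ⊆ Icc (-(ct * ρ ^ 2)) 0 := by
      rw [hρ₁, hρ'sq]; exact Ioc_subset_Icc_self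
    have hBv : closedBall (0 : EuclideanSpace ℝ (Fin 3)) ρ₁ ⊆ closedBall 0 (ρ / 2) := closedBall_subset_closedBall hρ'2
    have hBvρ : closedBall (0 : EuclideanSpace ℝ (Fin 3)) ρ₁ ⊆ closedBall 0 ρ := closedBall_subset_closedBall hρ'ρ
    -- pointwise bound of `g⁴` by `δ⁴ 1_{Φ < δ}` on the cylinder
    have hgpt : ∀ s ∈ Ioc (-ρ₁ ^ 2) 0, ∀ x ∈ closedBall (0 : EuclideanSpace ℝ (Fin 3)) ρ₁,
        ‖g (s, x)‖ₑ ^ (4 : ℝ) ≤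
          ({x | lam * F s x + (a + ε) < 2 * δ} ∩ closedBall (0 : EuclideanSpace ℝ (Fin 3)) (ρ / 2)).indicator
            (fun _ => ENNReal.ofReal (δ ^ 4)) x := by
      intro s hs x hx
      have hsI : s ∈ Icc (-ρ ^ 2) 0 := ⟨le_trans (by nlinarith) (hIv hs).1, hs.2⟩
      have hΦ0 := (hΦ s hsI x (hBvρ hx)).1
      by_cases hlt : lam * F s x + a < δ
      · have hmem : x ∈ {x | lam * F s x + (a + ε) < 2 * δ} ∩ closedBall (0 : EuclideanSpace ℝ (Fin 3)) (ρ / 2) := by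
          refine ⟨?_, hBv hx⟩
          show lam * F s x + (a + ε) < 2 * δ
          rw [hε]; linarith
        rw [indicator_of_mem hmem]
        have hgle : g (s, x) ≤ δ := by
          simp only [hgdef]
          refine max_le ?_ hδ0.le
          linarith
        rw [Real.enorm_eq_ofReal (hg0 _), ENNReal.ofReal_rpow_of_nonneg (hg0 _) (by norm_num)]
        refine ENNReal.ofReal_le_ofReal ?_
        rw [show ((4 : ℝ)) = ((4 : ℕ) : ℝ) by norm_num, Real.rpow_natCast]
        exact pow_le_pow_left₀ (hg0 _) hgle 4
      · have hg00 : g (s, x) = 0 := by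
          simp only [hgdef]
          refine max_eq_right ?_
          linarith
        rw [hg00, enorm_zero, ENNReal.zero_rpow_of_pos (by norm_num)]
        exact bot_le
    -- Tonelli and the sublevel bound: `∫∫ g⁴ ≤ ρ'² δ⁴ C₁ ρ³ / Lc`
    have hBq0 : 0 ≤ ρ₁ ^ 2 * (δ ^ 4 * (C₁ * ρ ^ 3 / Lc)) := by positivity
    have hlint : ∫⁻ z, ‖g z‖ₑ ^ (4 : ℝ) ∂(((volume : Measure ℝ).prod (volume : Measure (EuclideanSpace ℝ (Fin 3)))).restrict
        (Ioc (-ρ₁ ^ 2) 0 ×ˢ closedBall (0 : EuclideanSpace ℝ (Fin 3)) ρ₁)) ≤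
        ENNReal.ofReal (ρ₁ ^ 2 * (δ ^ 4 * (C₁ * ρ ^ 3 / Lc))) := by
      rw [← Measure.prod_restrict, lintegral_prod _ (hgc.measurable.enorm.pow_const _).aemeasurable]
      have hinner : ∀ s ∈ Ioc (-ρ₁ ^ 2) (0 : ℝ),
          ∫⁻ x in closedBall (0 : EuclideanSpace ℝ (Fin 3)) ρ₁, ‖g (s, x)‖ₑ ^ (4 : ℝ) ≤
            ENNReal.ofReal (δ ^ 4 * (C₁ * ρ ^ 3 / Lc)) := by
        intro s hs
        have hSm : MeasurableSet ({x | lam * F s x + (a + ε) < 2 * δ} ∩ closedBall (0 : EuclideanSpace ℝ (Fin 3)) (ρ / 2)) :=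
          (isOpen_lt ((continuous_const.mul (hF2 s).continuous).add continuous_const) continuous_const).measurableSet.inter
            measurableSet_closedBall
        calc ∫⁻ x in closedBall (0 : EuclideanSpace ℝ (Fin 3)) ρ₁, ‖g (s, x)‖ₑ ^ (4 : ℝ)
            ≤ ∫⁻ x in closedBall (0 : EuclideanSpace ℝ (Fin 3)) ρ₁,
                ({x | lam * F s x + (a + ε) < 2 * δ} ∩ closedBall (0 : EuclideanSpace ℝ (Fin 3)) (ρ / 2)).indicator
                  (fun _ => ENNReal.ofReal (δ ^ 4)) x :=
              setLIntegral_mono' measurableSet_closedBall fun x hx => hgpt s hs x hx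
          _ ≤ ∫⁻ x, ({x | lam * F s x + (a + ε) < 2 * δ} ∩ closedBall (0 : EuclideanSpace ℝ (Fin 3)) (ρ / 2)).indicator
                  (fun _ => ENNReal.ofReal (δ ^ 4)) x := setLIntegral_le_lintegral _ _
          _ = ENNReal.ofReal (δ ^ 4) * volume ({x | lam * F s x + (a + ε) < 2 * δ} ∩ closedBall (0 : EuclideanSpace ℝ (Fin 3)) (ρ / 2)) := by
              rw [lintegral_indicator hSm, setLIntegral_const]
          _ ≤ ENNReal.ofReal (δ ^ 4) * ENNReal.ofReal (C₁ * ρ ^ 3 / Lc) := by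
              have hv : volume ({x | lam * F s x + (a + ε) < 2 * δ} ∩ closedBall (0 : EuclideanSpace ℝ (Fin 3)) (ρ / 2)) ≤
                  ENNReal.ofReal (C₁ * ρ ^ 3 / Lc) := by
                rw [← ofReal_measureReal (measure_ne_top_of_subset inter_subset_right measure_closedBall_lt_top.ne)]
                exact ENNReal.ofReal_le_ofReal (hsub s (hIv hs))
              gcongr
          _ = ENNReal.ofReal (δ ^ 4 * (C₁ * ρ ^ 3 / Lc)) := (ENNReal.ofReal_mul (by positivity)).symm
      calc ∫⁻ s in Ioc (-ρ₁ ^ 2) (0 : ℝ), ∫⁻ x in closedBall (0 : EuclideanSpace ℝ (Fin 3)) ρ₁, ‖g (s, x)‖ₑ ^ (4 : ℝ)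
          ≤ ∫⁻ s in Ioc (-ρ₁ ^ 2) (0 : ℝ), ENNReal.ofReal (δ ^ 4 * (C₁ * ρ ^ 3 / Lc)) :=
            setLIntegral_mono' measurableSet_Ioc fun s hs => hinner s hs
        _ = ENNReal.ofReal (δ ^ 4 * (C₁ * ρ ^ 3 / Lc)) * volume (Ioc (-ρ₁ ^ 2) (0 : ℝ)) := setLIntegral_const _ _
        _ = ENNReal.ofReal (ρ₁ ^ 2 * (δ ^ 4 * (C₁ * ρ ^ 3 / Lc))) := by
            rw [Real.volume_Ioc, sub_neg_eq_add, zero_add, mul_comm, ← ENNReal.ofReal_mul (by positivity)]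
    have h4 : eLpNorm g (ENNReal.ofReal 4) ((((volume : Measure ℝ).prod (volume : Measure (EuclideanSpace ℝ (Fin 3)))).restrict
        (Ioc (-ρ₁ ^ 2) 0 ×ˢ closedBall (0 : EuclideanSpace ℝ (Fin 3)) ρ₁))) ≤
        ENNReal.ofReal ((ρ₁ ^ 2 * (δ ^ 4 * (C₁ * ρ ^ 3 / Lc))) ^ (1 / 4 : ℝ)) := by
      rw [eLpNorm_eq_lintegral_rpow_enorm_toReal (by norm_num) ENNReal.ofReal_ne_top, ENNReal.toReal_ofReal (by norm_num),
        ← ENNReal.ofReal_rpow_of_nonneg hBq0 (by norm_num)]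
      exact ENNReal.rpow_le_rpow hlint (by norm_num)
    -- ### the `L∞` bound: `(δ − Φ)₊ ≤ X ≤ δ/2` on `Q(ρ'/2)`
    set X : ℝ := Cmv * ρ₁ ^ (-(5 / 4 : ℝ)) * (ρ₁ ^ 2 * (δ ^ 4 * (C₁ * ρ ^ 3 / Lc))) ^ (1 / 4 : ℝ) with hX
    have hX0 : 0 ≤ X := by positivity
    have hsup : eLpNorm g ∞ ((((volume : Measure ℝ).prod (volume : Measure (EuclideanSpace ℝ (Fin 3)))).restrict
        (Ioc (-(ρ₁ / 2) ^ 2) 0 ×ˢ closedBall (0 : EuclideanSpace ℝ (Fin 3)) (ρ₁ / 2)))) ≤ ENNReal.ofReal X := by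
      refine hMVI.trans ?_
      calc ENNReal.ofReal (Cmv * ρ₁ ^ (-(5 / 4 : ℝ))) * eLpNorm g (ENNReal.ofReal 4)
            ((((volume : Measure ℝ).prod (volume : Measure (EuclideanSpace ℝ (Fin 3)))).restrict
              (Ioc (-ρ₁ ^ 2) 0 ×ˢ closedBall (0 : EuclideanSpace ℝ (Fin 3)) ρ₁)))
          ≤ ENNReal.ofReal (Cmv * ρ₁ ^ (-(5 / 4 : ℝ))) *
              ENNReal.ofReal ((ρ₁ ^ 2 * (δ ^ 4 * (C₁ * ρ ^ 3 / Lc))) ^ (1 / 4 : ℝ)) := by gcongr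
        _ = ENNReal.ofReal X := by rw [hX, ENNReal.ofReal_mul (p := Cmv * ρ₁ ^ (-(5 / 4 : ℝ))) (by positivity)]
    -- `X ≤ δ/2`: `X⁴ = Cmv⁴ ct^{-3/2} δ⁴ C₁ / Lc ≤ δ⁴/16`
    have hXle : X ≤ δ / 2 := by
      have hX4 : X ^ 4 = Cmv ^ 4 * ct ^ (-(3 / 2 : ℝ)) * C₁ / Lc * δ ^ 4 := by
        have hA4 : (ρ₁ ^ (-(5 / 4 : ℝ))) ^ 4 = (ρ₁ ^ 5)⁻¹ := by
          rw [← Real.rpow_natCast (ρ₁ ^ (-(5 / 4 : ℝ))) 4, ← Real.rpow_mul hρ'.le,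
            show (-(5 / 4 : ℝ)) * ((4 : ℕ) : ℝ) = -((5 : ℕ) : ℝ) by norm_num, Real.rpow_neg hρ'.le, Real.rpow_natCast]
        have hB4 : ((ρ₁ ^ 2 * (δ ^ 4 * (C₁ * ρ ^ 3 / Lc))) ^ (1 / 4 : ℝ)) ^ 4 = ρ₁ ^ 2 * (δ ^ 4 * (C₁ * ρ ^ 3 / Lc)) := by
          rw [← Real.rpow_natCast _ 4, ← Real.rpow_mul hBq0, show (1 / 4 : ℝ) * ((4 : ℕ) : ℝ) = 1 by norm_num, Real.rpow_one]
        have e7 : ct ^ (-(3 / 2 : ℝ)) = (ct * Real.sqrt ct)⁻¹ := by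
          rw [Real.rpow_neg hct0.le, show (3 / 2 : ℝ) = 1 + 1 / 2 by norm_num, Real.rpow_add hct0, Real.rpow_one,
            Real.sqrt_eq_rpow]
        have e8 : ρ₁ ^ 5 = ct ^ 2 * Real.sqrt ct * ρ ^ 5 := by
          rw [hρ₁, mul_pow]
          have h2 : Real.sqrt ct ^ 2 = ct := Real.sq_sqrt hct0.le
          have h5 : Real.sqrt ct ^ 5 = ct ^ 2 * Real.sqrt ct := by
            calc Real.sqrt ct ^ 5 = (Real.sqrt ct ^ 2) ^ 2 * Real.sqrt ct := by ring
              _ = ct ^ 2 * Real.sqrt ct := by rw [h2]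
          rw [h5]
        have e5 : ρ₁ ^ 2 = ct * ρ ^ 2 := by rw [hρ₁]; exact hρ'sq
        rw [hX, mul_pow, mul_pow, hA4, hB4, e7, e8, e5]
        field_simp
      have hbound : Cmv ^ 4 * ct ^ (-(3 / 2 : ℝ)) * C₁ / Lc ≤ 1 / 16 := by
        rw [div_le_iff₀ hLc0, hLc]
        nlinarith [show 0 ≤ Cmv ^ 4 * ct ^ (-(3 / 2 : ℝ)) * C₁ by positivity]
      have hX4le : X ^ 4 ≤ (δ / 2) ^ 4 := by
        rw [hX4, show (δ / 2) ^ 4 = 1 / 16 * δ ^ 4 by ring]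
        exact mul_le_mul_of_nonneg_right hbound (by positivity)
      exact (pow_le_pow_iff_left₀ hX0 (by positivity) (by norm_num : (4 : ℕ) ≠ 0)).1 hX4le
    -- from the essential supremum to every point of the closed small cylinder
    have hae : ∀ᵐ z ∂((((volume : Measure ℝ).prod (volume : Measure (EuclideanSpace ℝ (Fin 3)))).restrict
        (Ioc (-(ρ₁ / 2) ^ 2) 0 ×ˢ closedBall (0 : EuclideanSpace ℝ (Fin 3)) (ρ₁ / 2)))), g z ≤ X := by
      have h := ae_le_eLpNormEssSup (μ := (((volume : Measure ℝ).prod (volume : Measure (EuclideanSpace ℝ (Fin 3)))).restrict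
        (Ioc (-(ρ₁ / 2) ^ 2) 0 ×ˢ closedBall (0 : EuclideanSpace ℝ (Fin 3)) (ρ₁ / 2)))) (f := g)
      rw [← eLpNorm_exponent_top] at h
      filter_upwards [h] with z hz
      have h1 := hz.trans hsup
      rw [Real.enorm_eq_ofReal (hg0 z)] at h1
      exact (ENNReal.ofReal_le_ofReal_iff hX0).1 h1
    have hopen : IsOpen (Ioo (-(ρ₁ / 2) ^ 2) (0 : ℝ) ×ˢ ball (0 : EuclideanSpace ℝ (Fin 3)) (ρ₁ / 2)) :=
      isOpen_Ioo.prod isOpen_ball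
    have hOsub : Ioo (-(ρ₁ / 2) ^ 2) (0 : ℝ) ×ˢ ball (0 : EuclideanSpace ℝ (Fin 3)) (ρ₁ / 2) ⊆
        Ioc (-(ρ₁ / 2) ^ 2) 0 ×ˢ closedBall (0 : EuclideanSpace ℝ (Fin 3)) (ρ₁ / 2) :=
      prod_mono Ioo_subset_Ioc_self ball_subset_closedBall
    have hO : ∀ z ∈ Ioo (-(ρ₁ / 2) ^ 2) (0 : ℝ) ×ˢ ball (0 : EuclideanSpace ℝ (Fin 3)) (ρ₁ / 2), g z ≤ X :=
      le_of_ae_le_of_continuousOn (μ := ((volume : Measure ℝ).prod (volume : Measure (EuclideanSpace ℝ (Fin 3)))))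
        hopen hgc.continuousOn (ae_restrict_of_ae_restrict_of_subset hOsub hae)
    have hclos : closure (Ioo (-(ρ₁ / 2) ^ 2) (0 : ℝ) ×ˢ ball (0 : EuclideanSpace ℝ (Fin 3)) (ρ₁ / 2)) =
        Icc (-(ρ₁ / 2) ^ 2) 0 ×ˢ closedBall (0 : EuclideanSpace ℝ (Fin 3)) (ρ₁ / 2) := by
      have hne : (-(ρ₁ / 2) ^ 2 : ℝ) ≠ 0 := (neg_lt_zero.2 (by positivity : (0 : ℝ) < (ρ₁ / 2) ^ 2)).ne
      rw [closure_prod_eq, closure_Ioo hne, closure_ball _ (by positivity : ρ₁ / 2 ≠ 0)]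
    have hall : ∀ z ∈ Icc (-(ρ₁ / 2) ^ 2) 0 ×ˢ closedBall (0 : EuclideanSpace ℝ (Fin 3)) (ρ₁ / 2), g z ≤ X := by
      intro z hz
      rw [← hclos] at hz
      exact le_on_closure hO hgc.continuousOn continuousOn_const hz
    -- conclude
    intro p' hp'
    have hpz : p' ∈ Icc (-(ρ₁ / 2) ^ 2) 0 ×ˢ closedBall (0 : EuclideanSpace ℝ (Fin 3)) (ρ₁ / 2) := by
      have e : θ * ρ = ρ₁ / 2 := by rw [hρ₁]; exact hθρ
      rw [e] at hp'; exact hp'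
    have h1 := hall p' hpz
    have h2 : δ - a - (lam * F p'.1 p'.2 + 0) ≤ g p' := le_max_left _ _
    linarith
  -- ### the two normalisations
  have hJne : J ≠ 0 := hJpos.ne'
  have hmJ : -2 * m / J + 2 * M / J = 2 := by
    field_simp
    rw [hJ]; ring
  by_cases ha₁ : 1 ≤ -2 * m / J
  · -- `Φ = 2(F − m)/J = (2/J) F + (−2m/J)`
    have hΦ : ∀ s ∈ Icc (-ρ ^ 2) 0, ∀ x ∈ closedBall (0 : EuclideanSpace ℝ (Fin 3)) ρ,
        0 ≤ 2 / J * F s x + -2 * m / J ∧ 2 / J * F s x + -2 * m / J ≤ 2 := by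
      intro s hs x hx
      obtain ⟨h1, h2⟩ := hmM s hs x hx
      have e : 2 / J * F s x + -2 * m / J = 2 * (F s x - m) / J := by field_simp; ring
      rw [e]
      constructor
      · exact div_nonneg (by linarith) hJpos.le
      · rw [div_le_iff₀ hJpos, hJ]; linarith
    have hk := key (2 / J) (-2 * m / J) ha₁ hΦ q hq
    have e : 2 / J * F q.1 q.2 + -2 * m / J = 2 * (F q.1 q.2 - m) / J := by field_simp; ring
    rw [e, le_div_iff₀ hJpos] at hk
    linarith [hFp.2, hk, hJ]
  · -- `Φ = 2(M − F)/J = (−2/J) F + 2M/J`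
    have ha₂ : 1 ≤ 2 * M / J := by linarith
    have hΦ : ∀ s ∈ Icc (-ρ ^ 2) 0, ∀ x ∈ closedBall (0 : EuclideanSpace ℝ (Fin 3)) ρ,
        0 ≤ -2 / J * F s x + 2 * M / J ∧ -2 / J * F s x + 2 * M / J ≤ 2 := by
      intro s hs x hx
      obtain ⟨h1, h2⟩ := hmM s hs x hx
      have e : -2 / J * F s x + 2 * M / J = 2 * (M - F s x) / J := by field_simp; ring
      rw [e]
      constructor
      · exact div_nonneg (by linarith) hJpos.le
      · rw [div_le_iff₀ hJpos, hJ]; linarith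
    have hk := key (-2 / J) (2 * M / J) ha₂ hΦ p hp
    have e : -2 / J * F p.1 p.2 + 2 * M / J = 2 * (M - F p.1 p.2) / J := by field_simp; ring
    rw [e, le_div_iff₀ hJpos] at hk
    linarith [hFq.1, hk, hJ]

end LeiZhang2011

end Literature.Analysis.FluidPDE
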